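import Summits.BirchSwinnertonDyer.BirchSwinnertonDyer.Theses.PrintCf2
import Literature.NumberTheory.EllipticCurves.Agboola2007.RestrictedSelmerDualProofs
import Literature.NumberTheory.EllipticCurves.IwasawaAlgebraProofs
import Literature.NumberTheory.EllipticCurves.EndomorphismEigenPrimaryTorsion
import HarnessLib

/-!
# Stub-ideation k1 (g3) sketch for `stub_heegnerIndexLowerAtTwo` (crux `PrintCf2.SplitBadTwoLowerHalfOfFacts`,
# item stmt-BirchSwinnertonDyer-27851) — the `[−1]`-INVOLUTION SANDWICH: the minus-branch CONTAINMENT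
# `char 𝔖(K*_∞, W*)^∨ ⊆ (L_v(ψ*))` from two `Δ`-FREE total main-conjecture statements, by exact-sequence
# algebra that needs NO idempotent `(1 ± c)/2` (the obstruction `2 ∣ #Δ` of Rubin 1991 §11 / JLK §5.4).

BSD is NOT proved by any of this; nothing here closes the crux or the stub. §A–§B are PROVED commutative
algebra (sorry-free); §C types the research frame as hypotheses (`structure` + `Prop`s, no axioms, no sorry)
and proves the assembly; §D records the ONE research existence stub as a `theorem … := by sorry`.
-/

set_option autoImplicit false
set_option linter.dupNamespace false

noncomputable section

open scoped Classical NumberField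

namespace Summit.BirchSwinnertonDyer.BirchSwinnertonDyer.Cruxes.SplitBadTwoLowerHalfOfFacts.StubIdeasK1G3

open Literature.NumberTheory.EllipticCurves IsDedekindDomain

/-! ## §A  Ideal cancellation in a domain (the «divide out the plus branch» step) -/

section Cancel

variable {R : Type*} [CommRing R] [IsDomain R]

/-- **A1 (cancellation).** If `I⁻·I⁺ ⊆ C ⊆ (L⁺·L⁻)` and `(L⁺) ⊆ I⁺` with `L⁺ ≠ 0`, then `I⁻ ⊆ (L⁻)`.
This is the whole «component extraction» at `p = 2`: no idempotents, only cancellation in a domain. -/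
theorem le_span_singleton_of_sandwich {Im Ip C : Ideal R} {Lp Lm : R} (hLp : Lp ≠ 0)
    (hsand : Im * Ip ≤ C) (htot : C ≤ Ideal.span {Lp * Lm}) (hES : Ideal.span {Lp} ≤ Ip) :
    Im ≤ Ideal.span {Lm} := by
  intro x hx
  have hx' : x * Lp ∈ Ideal.span {Lp * Lm} :=
    htot (hsand (Ideal.mul_mem_mul hx (hES (Ideal.mem_span_singleton_self Lp))))
  obtain ⟨r, hr⟩ := Ideal.mem_span_singleton'.mp hx'
  refine Ideal.mem_span_singleton'.mpr ⟨r, mul_left_cancel₀ hLp ?_⟩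
  linear_combination hr

end Cancel

/-! ## §B  The exact-sequence sandwich `char(Y/bY)·char(Y/aY) ⊆ char(Y)` for `a ∘ b = 0`
(involution case: `a = c − 1`, `b = c + 1`) over any Noetherian domain -/

section Sandwich

variable {R : Type*} [CommRing R] {Y : Type*} [AddCommGroup Y] [Module R Y]

/-- A quotient of a torsion module is torsion. [folklore] -/
theorem isTorsion_quotient (N : Submodule R Y) (hY : Module.IsTorsion R Y) :
    Module.IsTorsion R (Y ⧸ N) := by
  intro q
  induction q using Submodule.Quotient.induction_on with
  | H y =>
    obtain ⟨a, ha⟩ := @hY y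
    refine ⟨a, ?_⟩
    change ((a : R)) • (Submodule.Quotient.mk y : Y ⧸ N) = 0
    rw [← Submodule.Quotient.mk_smul, show (a : R) • y = 0 from ha, Submodule.Quotient.mk_zero]

variable [IsNoetherianRing R] [IsDomain R] [Module.Finite R Y]

/-- **B1 (sandwich).** For endomorphisms `a b` of a finitely generated torsion module `Y` over a Noetherian
domain with `a ∘ b = 0`: `char(Y/bY) · char(Y/aY) ⊆ char(Y)`.  Proof: `Y/bY ↠ aY` (as `b Y ⊆ ker a`), so
`char(Y/bY) = char(ker)·char(aY) ⊆ char(aY)`, and `char(Y) = char(aY)·char(Y/aY)` (`0 → aY → Y → Y/aY → 0`). -/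
theorem charIdeal_quot_mul_le_of_comp_eq_zero (hY : Module.IsTorsion R Y) (a b : Y →ₗ[R] Y)
    (hab : a ∘ₗ b = 0) :
    Module.charIdeal R (Y ⧸ LinearMap.range b) * Module.charIdeal R (Y ⧸ LinearMap.range a) ≤
      Module.charIdeal R Y := by
  have hle : LinearMap.range b ≤ LinearMap.ker a.rangeRestrict := by
    rintro _ ⟨y, rfl⟩
    rw [LinearMap.mem_ker]
    apply Subtype.ext
    change a (b y) = 0
    rw [← LinearMap.comp_apply, hab, LinearMap.zero_apply]
  set φ : (Y ⧸ LinearMap.range b) →ₗ[R] LinearMap.range a := (LinearMap.range b).liftQ a.rangeRestrict hle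
  have hφ : Function.Surjective φ := by
    rintro ⟨_, y, rfl⟩
    exact ⟨Submodule.Quotient.mk y, rfl⟩
  have h1 : Module.charIdeal R (Y ⧸ LinearMap.range b) =
      Module.charIdeal R (LinearMap.ker φ) * Module.charIdeal R (LinearMap.range a) :=
    Module.charIdeal_eq_mul_of_exact (isTorsion_quotient _ hY) (LinearMap.ker φ).subtype φ
      (Submodule.injective_subtype _) hφ (LinearMap.exact_subtype_ker_map φ)
  have h2 : Module.charIdeal R Y =
      Module.charIdeal R (LinearMap.range a) * Module.charIdeal R (Y ⧸ LinearMap.range a) :=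
    Module.charIdeal_eq_mul_of_exact hY (LinearMap.range a).subtype (LinearMap.range a).mkQ
      (Submodule.injective_subtype _) (Submodule.mkQ_surjective _) (LinearMap.exact_subtype_mkQ _)
  rw [h1, h2]
  exact Ideal.mul_mono_left Ideal.mul_le_left

/-- **B1′ (the defect is Tate cohomology).** With `a ∘ b = 0` as in B1, EXACTLY:
`char(Y/bY)·char(Y/aY) = char(ker a / (ker a ∩ bY))·char(Y)`; for an involution (`a = c−1`, `b = c+1`) the
defect module is `Y^{c=1}/(c+1)Y = Ĥ⁰(⟨c⟩, Y)`, killed by `2` — pseudo-null iff finite (a `μ = 0`-type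
condition). LOWER needs only B1's containment, hence no `μ`-input. -/
theorem charIdeal_quot_mul_eq_of_comp_eq_zero (hY : Module.IsTorsion R Y) (a b : Y →ₗ[R] Y)
    (hab : a ∘ₗ b = 0) :
    Module.charIdeal R (Y ⧸ LinearMap.range b) * Module.charIdeal R (Y ⧸ LinearMap.range a) =
      Module.charIdeal R ↥(Submodule.map (LinearMap.range b).mkQ (LinearMap.ker a)) *
        Module.charIdeal R Y := by
  have hle : LinearMap.range b ≤ LinearMap.ker a.rangeRestrict := by
    rintro _ ⟨y, rfl⟩
    rw [LinearMap.mem_ker]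
    apply Subtype.ext
    change a (b y) = 0
    rw [← LinearMap.comp_apply, hab, LinearMap.zero_apply]
  set φ : (Y ⧸ LinearMap.range b) →ₗ[R] LinearMap.range a := (LinearMap.range b).liftQ a.rangeRestrict hle
  have hφ : Function.Surjective φ := by
    rintro ⟨_, y, rfl⟩
    exact ⟨Submodule.Quotient.mk y, rfl⟩
  have hker : LinearMap.ker φ = Submodule.map (LinearMap.range b).mkQ (LinearMap.ker a) := by
    apply le_antisymm
    · intro q hq
      induction q using Submodule.Quotient.induction_on with
      | H y =>
        refine ⟨y, ?_, rfl⟩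
        rw [LinearMap.mem_ker] at hq
        rw [SetLike.mem_coe, LinearMap.mem_ker]
        have := congrArg Subtype.val hq
        simpa [φ] using this
    · rintro _ ⟨z, hz, rfl⟩
      rw [SetLike.mem_coe, LinearMap.mem_ker] at hz
      rw [LinearMap.mem_ker]
      apply Subtype.ext
      simpa [φ] using hz
  have h1 : Module.charIdeal R (Y ⧸ LinearMap.range b) =
      Module.charIdeal R (LinearMap.ker φ) * Module.charIdeal R (LinearMap.range a) :=
    Module.charIdeal_eq_mul_of_exact (isTorsion_quotient _ hY) (LinearMap.ker φ).subtype φ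
      (Submodule.injective_subtype _) hφ (LinearMap.exact_subtype_ker_map φ)
  have h2 : Module.charIdeal R Y =
      Module.charIdeal R (LinearMap.range a) * Module.charIdeal R (Y ⧸ LinearMap.range a) :=
    Module.charIdeal_eq_mul_of_exact hY (LinearMap.range a).subtype (LinearMap.range a).mkQ
      (Submodule.injective_subtype _) (Submodule.mkQ_surjective _) (LinearMap.exact_subtype_mkQ _)
  rw [hker] at h1
  rw [h1, h2]; ring

/-- **B2 (involution).** For an involution `c` of `Y`: `char(Y/(c+1)Y) · char(Y/(c−1)Y) ⊆ char(Y)` —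
the `p = 2` replacement for `Y ≅ Y⁺ ⊕ Y⁻`. -/
theorem charIdeal_minus_mul_plus_le (hY : Module.IsTorsion R Y) (c : Y →ₗ[R] Y)
    (hc : ∀ y, c (c y) = y) :
    Module.charIdeal R (Y ⧸ LinearMap.range (c + LinearMap.id)) *
        Module.charIdeal R (Y ⧸ LinearMap.range (c - LinearMap.id)) ≤ Module.charIdeal R Y := by
  refine charIdeal_quot_mul_le_of_comp_eq_zero hY (c - LinearMap.id) (c + LinearMap.id) ?_
  ext y
  simp [map_add, hc]

/-- **B3 (minus containment from totals).** `Λ → Λ'` any ring map into a domain (e.g. `PowerSeries.map J`,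
`J : ℤ₂ → 𝒪_{ℂ₂}`); `Y` f.g. torsion with involution `c`; `I⁻ = char(Y/(c+1)Y)`, `I⁺ = char(Y/(c−1)Y)`.
TOTAL containment `char(Y)·Λ' ⊆ (G⁺·G)` and plus-side divisibility `(G⁺) ⊆ I⁺·Λ'`, `G⁺ ≠ 0`, give the
MINUS containment `I⁻·Λ' ⊆ (G)`. -/
theorem minus_map_le_span_of_totals {Λ Λ' : Type*} [CommRing Λ] [IsNoetherianRing Λ] [IsDomain Λ]
    [CommRing Λ'] [IsDomain Λ'] (J : Λ →+* Λ')
    {Y : Type*} [AddCommGroup Y] [Module Λ Y] [Module.Finite Λ Y] (hY : Module.IsTorsion Λ Y)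
    (c : Y →ₗ[Λ] Y) (hc : ∀ y, c (c y) = y) {Im Ip : Ideal Λ}
    (hminus : Module.charIdeal Λ (Y ⧸ LinearMap.range (c + LinearMap.id)) = Im)
    (hplus : Module.charIdeal Λ (Y ⧸ LinearMap.range (c - LinearMap.id)) = Ip)
    {Gp G : Λ'} (hGp : Gp ≠ 0)
    (htot : (Module.charIdeal Λ Y).map J ≤ Ideal.span {Gp * G})
    (hES : Ideal.span {Gp} ≤ Ip.map J) :
    Im.map J ≤ Ideal.span {G} := by
  refine le_span_singleton_of_sandwich (C := (Module.charIdeal Λ Y).map J) hGp ?_ htot hES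
  rw [← Ideal.map_mul, ← hminus, ← hplus]
  exact Ideal.map_mono (charIdeal_minus_mul_plus_le hY c hc)


/-- **B4 (value-level sandwich, for the print-adjacent variant).** In a domain: `Gp·G ∣ fm·fp`, `fp ∣ Gp`,
`fp ≠ 0` give `G ∣ fm`.  Applied to constant terms in the valuation ring `𝒪_{ℂ₂}` (`x ∣ y ↔ v(x) ≤ v(y)`):
`v(G(0)) ≤ v(fm(0)) = n` from the two ideal sandwiches evaluated at `T = 0` and the SISTER BOTTOM inequality
`v(fp(0)) ≤ v(Gp(0))` (rank-`0` sister: BSD(`E₀/K₀`) at `2` is in print, LTYZ 2025 Thm 3.8). -/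
theorem dvd_of_mul_dvd_mul_of_dvd {𝒪 : Type*} [CommRing 𝒪] [IsDomain 𝒪] {Gp G fm fp : 𝒪}
    (h1 : Gp * G ∣ fm * fp) (h2 : fp ∣ Gp) (hfp : fp ≠ 0) : G ∣ fm := by
  obtain ⟨t, ht⟩ := h1
  obtain ⟨s, hs⟩ := h2
  refine ⟨s * t, mul_right_cancel₀ hfp ?_⟩
  rw [ht, hs]; ring

/-- **B5.** Divisibility of power series passes to constant terms (evaluation at `T = 0`). -/
theorem constantCoeff_mul_dvd {𝒪 : Type*} [CommRing 𝒪] {Gp G fm fp : PowerSeries 𝒪}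
    (h : Gp * G ∣ fm * fp) :
    PowerSeries.constantCoeff Gp * PowerSeries.constantCoeff G ∣
      PowerSeries.constantCoeff fm * PowerSeries.constantCoeff fp := by
  simpa [map_mul] using map_dvd PowerSeries.constantCoeff h

/-- **B6.** Ideal sandwiches to element divisibility: `I⁻·I⁺ ⊆ (fY)`, `(fY) ⊆ (Gp·G)`, `fm ∈ I⁻`, `fp ∈ I⁺`
give `Gp·G ∣ fm·fp`. -/
theorem mul_dvd_mul_of_sandwich {Λ' : Type*} [CommRing Λ'] {Im Ip : Ideal Λ'} {fY Gp G fm fp : Λ'}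
    (hsand : Im * Ip ≤ Ideal.span {fY}) (htot : Ideal.span {fY} ≤ Ideal.span {Gp * G})
    (hm : fm ∈ Im) (hp : fp ∈ Ip) : Gp * G ∣ fm * fp :=
  Ideal.mem_span_singleton.mp (htot (hsand (Ideal.mul_mem_mul hm hp)))

end Sandwich

/-! ## §C  The arithmetic frame of the sandwich, TYPED AS HYPOTHESES (no axiom, no sorry), and the assembly

Frame of the LOWER child (α⁻ road, critic STUB-PLAN v1.3 T1⁻): `K` imaginary quadratic with `2 = v·v̄` split,
`M = W* = (W.baseChange K).endEigenPrimaryTorsion 2 π r` (Galois module `≅ ℚ₂/ℤ₂`), `κ'` THE `ℤ₂`-extension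
`K*_∞/K` unramified outside `v̄`, generator `γ'`, `D : Agboola2007.RestrictedDualData κ' M v̄ γ'` (dual of the
`v̄`-restricted, `v`-relaxed Selmer group over `K*_∞`), `J : ℤ₂ → 𝒪_{ℂ₂}`, `G` the line's Katz branch.
The SANDWICH FRAME adds: `F_∞ := K(M) = K*_∞ · F₀`, `F₀ := K(M[4])` quadratic over `K`, `Gal(F_∞/K*_∞) = ⟨c₀⟩`,
`c₀ = [−1] ∈ Aut M`; `Y := X^{(v)}(F_∞)` (Galois group of the maximal abelian pro-`2` extension of `F_∞`
unramified outside `v`, `κ'⁻¹`-twisted), a f.g. torsion `Λ`-module with the involution `c` induced by `c₀`;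
`Y/(c+1)Y ∼ D.X` (restriction to `Δ = ⟨c₀⟩`; `H¹(Δ, M) = 0`, `H²(Δ, M) = ℤ/2`) and `Y/(c−1)Y ∼ X*(M ⊗ ω)`,
`ω` the quadratic character of `F₀/K` (`Y_{Δ} = X^{(v)}(K*_∞)` up to the finite inertia of `F_∞/K*_∞`):
the restricted dual datum `Dplus` of the SISTER module `M ⊗ ω` on the SAME line, with sister branch `Gp`. -/

section Frame

universe u

variable {K : Type} [Field K] [NumberField K] (κ' : ZpExtension K 2)
  (M : Type) [AddCommGroup M] [DistribMulAction (Field.absoluteGaloisGroup K) M]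
  [TopologicalSpace M] [DiscreteTopology M]
  (vbar : HeightOneSpectrum (𝓞 K)) (γ' : Field.absoluteGaloisGroup K)

/-- **The sandwich frame** over a restricted dual datum `D` (all identifications are FIELDS = hypotheses). -/
structure SandwichFrame (D : Agboola2007.RestrictedDualData κ' M vbar γ') where
  /-- the total module `Y = X^{(v)}(K(M))` (twisted), over `Λ = ℤ₂⟦T⟧`, `1 + T ↔ γ'` -/
  Y : Type
  [acgY : AddCommGroup Y]
  [modY : Module (IwasawaAlgebra 2) Y]
  [finY : Module.Finite (IwasawaAlgebra 2) Y]
  torsY : Module.IsTorsion (IwasawaAlgebra 2) Y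
  /-- the involution induced by `c₀ = [−1] ∈ Gal(K(M)/K*_∞)` -/
  c : Y →ₗ[IwasawaAlgebra 2] Y
  invol : ∀ y, c (c y) = y
  /-- the quadratic character `ω` of `K(M[4])/K` and the sister module `M ⊗ ω` -/
  ω : Field.absoluteGaloisGroup K →* ℤˣ
  ω_ker : ∀ σ : Field.absoluteGaloisGroup K, ω σ = 1 ↔ ∀ x : M, 4 • x = 0 → σ • x = x
  Mplus : Type
  [acgP : AddCommGroup Mplus]
  [actP : DistribMulAction (Field.absoluteGaloisGroup K) Mplus]
  [topP : TopologicalSpace Mplus]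
  [discP : DiscreteTopology Mplus]
  e : M ≃+ Mplus
  twist : ∀ (σ : Field.absoluteGaloisGroup K) (x : M), e (σ • x) = ((ω σ : ℤˣ) : ℤ) • σ • e x
  /-- the restricted dual datum of the sister module on the same line -/
  Dplus : Agboola2007.RestrictedDualData κ' Mplus vbar γ'
  finP : Module.Finite (IwasawaAlgebra 2) Dplus.X
  /-- minus identification: `char(Y/(c+1)Y) = char 𝔖(K*_∞, M)^∨` -/
  minus_id : Module.charIdeal (IwasawaAlgebra 2) (Y ⧸ LinearMap.range (c + LinearMap.id)) = D.charIdeal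
  /-- plus identification: `char(Y/(c−1)Y) = char 𝔖(K*_∞, M ⊗ ω)^∨` -/
  plus_id : Module.charIdeal (IwasawaAlgebra 2) (Y ⧸ LinearMap.range (c - LinearMap.id)) = Dplus.charIdeal

attribute [instance] SandwichFrame.acgY SandwichFrame.modY SandwichFrame.finY SandwichFrame.acgP
  SandwichFrame.actP SandwichFrame.topP SandwichFrame.discP

variable {κ' M vbar γ'} {D : Agboola2007.RestrictedDualData κ' M vbar γ'}

/-- **C2 = TOT(F₀)** — the total one-variable main conjecture over the quadratic base `F₀ = K(M[4])` along
`F₀·K*_∞`, CONTAINMENT direction, in the currency of the line: `char(Y)·𝒪⟦T⟧ ⊆ (Gp·G)` (`Gp·G` = the norm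
`N_{Λ[Δ]/Λ}` of the `Δ × Γ'`-equivariant measure = product of the two `K`-branches; research-M, `Δ`-FREE). -/
def TotalContainment (F : SandwichFrame κ' M vbar γ' D) (J : ℤ_[2] →+* PadicComplexInt 2)
    (Gp G : PowerSeries (PadicComplexInt 2)) : Prop :=
  (Module.charIdeal (IwasawaAlgebra 2) F.Y).map (PowerSeries.map J) ≤ Ideal.span {Gp * G}

/-- **C3 = ES(K, sister)** — Euler-system divisibility for the sister module over the `Δ = 1` line `K*_∞/K`:
`(Gp) ⊆ char 𝔖(K*_∞, M ⊗ ω)^∨ · 𝒪⟦T⟧` (Rubin 1991 Thm 4.1(i)-shape with `F = K`, so `p ∤ [F:K]` trivially;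
research-S/M at `p = 2`), and `Gp ≠ 0` (Brumer–Baker / non-vanishing of the branch). -/
def SisterDivisibility (F : SandwichFrame κ' M vbar γ' D) (J : ℤ_[2] →+* PadicComplexInt 2)
    (Gp : PowerSeries (PadicComplexInt 2)) : Prop :=
  Gp ≠ 0 ∧ Ideal.span {Gp} ≤ (F.Dplus.charIdeal).map (PowerSeries.map J)

/-- **ASSEMBLY (proved): the minus-branch containment `char 𝔖(K*_∞, W*)^∨ · 𝒪⟦T⟧ ⊆ (G)`** — the one-sided
half of S3a∘S3b′ that the LOWER child consumes (critic T1⁻) — from a sandwich frame, TOT(F₀) and ES(K, sister). -/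
theorem restrictedCharIdeal_map_le_span_of_sandwich [Module.Finite (IwasawaAlgebra 2) D.X]
    (F : SandwichFrame κ' M vbar γ' D) (J : ℤ_[2] →+* PadicComplexInt 2)
    (Gp G : PowerSeries (PadicComplexInt 2))
    (hTot : TotalContainment F J Gp G) (hES : SisterDivisibility F J Gp) :
    (D.charIdeal).map (PowerSeries.map J) ≤ Ideal.span {G} :=
  minus_map_le_span_of_totals (PowerSeries.map J) F.torsY F.c F.invol F.minus_id F.plus_id hES.1 hTot hES.2

end Frame

/-! ## §D  The ONE research existence stub (Galois theory + Iwasawa-module control; research-S/M)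

For the LOWER child's pinned datum: a sandwich frame EXISTS. Content: `F_∞ = K(W[v̄^∞])`, `Y = X^{(v)}(F_∞)`
twisted by `κ'⁻¹`; `c = [−1]`; restriction along `Δ = Gal(F_∞/K*_∞) ≅ ℤ/2` (cokernel `⊆ H²(Δ, M) = ℤ/2`,
kernel `H¹(Δ, M) = 0` since `c₀ − 1 = −2` is onto `M ≅ ℚ₂/ℤ₂`); `Y_Δ ≅ X^{(v)}(K*_∞)(M ⊗ ω)` up to the
images of the (finitely many, order `≤ 2`) inertia groups of `F_∞/K*_∞` — finite = pseudo-null, invisible to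
`char`. -/

section Stub

/-- **stub (research-S/M): existence of the sandwich frame for the child's pinned datum.** For every member
`W`, imaginary quadratic `K` with `2 = v v̄`, pinned `(π, r)` with `M = W*`, and every line `κ'` unramified
outside `v̄` with generator `γ'` and restricted dual datum `D`: a `SandwichFrame` exists. -/
theorem stub_sandwichFrame_exists_two :
    ∀ (W : WeierstrassCurve ℚ) [W.IsElliptic], W.HasCM →
    ∀ (K : Type) [Field K] [NumberField K], IsImaginaryQuadratic K →
    ∀ (v vbar : HeightOneSpectrum (𝓞 K)),
      ((2 : ℕ) : 𝓞 K) ∈ v.asIdeal → ((2 : ℕ) : 𝓞 K) ∈ vbar.asIdeal → vbar ≠ v →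
    ∀ (π : (W.baseChange K).endRing) (r : ℤ_[2]), r * r = r - 2 →
    ∀ (κ' : ZpExtension K 2), κ'.IsUnramifiedOutside vbar → ∀ (γ' : Field.absoluteGaloisGroup K), κ'.IsTopGenerator γ' →
    ∀ (D : Agboola2007.RestrictedDualData κ' ↥((W.baseChange K).endEigenPrimaryTorsion 2 π r) vbar γ'),
      Module.Finite (IwasawaAlgebra 2) D.X →
      Nonempty (SandwichFrame κ' ↥((W.baseChange K).endEigenPrimaryTorsion 2 π r) vbar γ' D) := by
  sorry

end Stub

end Summit.BirchSwinnertonDyer.BirchSwinnertonDyer.Cruxes.SplitBadTwoLowerHalfOfFacts.StubIdeasK1G3
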